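/-
Origin: expansion seat `planner-pub-hodgecm-pv11-g2-0`, handover #3 2026-08-18T05:00:45Z (`HOME/pub-hodgecm-pv11-g2/lean/Pv11g2/SupplyToyModel.lean`, md5 2280d895, 207 lines);
landed by the gen-6 packager in gate run 22 as `HodgeCM/Model/Toy/SupplyCircleModel.lean` (import ^import Pv[0-9]+g[0-9]+\.→import HodgeCM.PerL34. ×1; stripped 2 #print/#check/#eval lines).
-/
import Summits.HodgeConjecture.HodgeCM.PerL34.SupplyCoset
import Mathlib.MeasureTheory.Measure.Haar.Basic
import Mathlib.Analysis.Calculus.BumpFunction.InnerProduct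
import Mathlib.LinearAlgebra.FreeModule.PID
import Mathlib.RingTheory.Finiteness.Basic

/-!
# A toy Schrödinger model in which every hypothesis of route (E) is DISCHARGED (non-vacuity witness)

Unit `pub-hodgecm-pv11-g2` (DAG node #11, gen 2).  Proposed final place:
`HodgeCM/PerL34/Toy/SupplyCircleModel.lean` (TOY / WITNESS file, kind L5-like for the theta layer; it is an
input of NOTHING).  Import rewrites on landing: `Pv11g2.SupplyCoset → HodgeCM.PerL34.SupplyCoset`.

PURPOSE.  `SupplyCoset.supply₁_of_coset_schwartz` (route (E) with D4 pushed back to the definition of the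
theta kernel) carries, besides kernel-proved inputs, the labelled hypotheses `CharSeparating` (PRINT),
`hker` (D4 at definition level), `hcont`, `heq` (D5), finiteness of `V(K) ∩ L̂` (SETUP) and the measure
instances on `[U(W₁)]`.  A referee may ask whether this hypothesis SET is consistent and whether the
dictionary sentences are of the kind that hold by unfolding definitions in a model.  This file answers
both in the smallest honest model, the WEIGHT-`k` CIRCLE MODEL:

* `G_U(𝔸) := Unit`, `[U(W₁)] := Circle` (a compact abelian group), rational points `X₁ := ℚ = V(K)`,
  "Schwartz–Bruhat space" `S₁ := ℚ → ℂ` (all functions), `ev₁ φ x := φ x`, and the Weil-type action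
  `ω₁ g u φ := u ^ k • φ` (the torus acts through the weight-`k` character — the archimedean type);
* hence, BY DEFINITION of `ThetaSeesawData.thetaKernel₁`, `θ_φ(g,u) = u ^ k · Σ'_{x ∈ ℚ} φ x`;
* `V(𝔸_f) := ℚ`, `L̂ := ℤ`, so `L = V(K) ∩ L̂ = ℤ`; `V_∞ := ℝ ⊃ LE := ℤ`, `ι_∞ = ι_f =` the inclusions;
* `φ_N := 1_{x₀ + Nℤ} · (f ∘ ι_∞)` for a Schwartz `f` on `ℝ`.

THEN (all kernel, this file): `hker` holds by `rfl`-level unfolding (`thetaKernel₁_one`), `hcont` is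
continuity of `u ↦ u ^ k`, `heq` is `mul_pow`, `CharSeparating Circle` is gen-1
`charSeparating_circle`, `ℤ` is finite free, the Borel σ-algebra and a Haar measure on `Circle`
provide the measure instances, and a smooth bump provides `f` with `f x₀ ≠ 0`.  The route-(E) theorem
then PRODUCES (`circleModel_supply_haar`, a closed theorem with no hypotheses at all): some `N ≥ 1` and a
continuous unitary character `χ` of the circle with `χ(t) · t ^ k = 1` for all `t` — i.e. `χ = t ↦ t^{-k}`,
the character FORCED BY THE WEIGHT — whose theta lift of `φ_N` is non-zero.

What this does NOT show: anything about the actual adelic Weil representation (D4 proper); the toy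
collapses `V(𝔸_f)` to `ℚ` and `𝒮` to all functions.  It shows exactly: the hypothesis set of route (E)
is jointly satisfiable, non-degenerate (infinite `X₁`, non-trivial torus action), and its dictionary
sentences are definitional in a model of the intended SHAPE.

No statement of the 2001 programme, of PerL or of QW8 is used or cited.
-/

set_option autoImplicit false

noncomputable section

open MeasureTheory Filter Topology Module
open scoped SchwartzMap
open HodgeCM.PerL34.Seesaw HodgeCM.PerL34.SupplyElementary HodgeCM.PerL34.LatticeTheta
  HodgeCM.PerL34.RationalCoset HodgeCM.PerL34.SupplyCoset

namespace HodgeCM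
namespace PerL34
namespace SupplyToyModel

/-- The weight-`k` circle model of the theta shell `ThetaSeesawData` (both sides equal; only side 1
is exercised below). -/
@[reducible] def circleModel (k : ℕ) : ThetaSeesawData where
  G := Unit
  A₁ := Circle
  A₂ := Circle
  X₁ := ℚ
  X₂ := ℚ
  S₁ := ℚ → ℂ
  S₂ := ℚ → ℂ
  S := ℚ × ℚ → ℂ
  ev₁ := fun φ x => φ x
  ev₂ := fun φ x => φ x
  ev := fun Φ z => Φ z
  tmul := fun φ₁ φ₂ z => φ₁ z.1 * φ₂ z.2
  ω₁ := fun _ u φ x => (u : ℂ) ^ k * φ x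
  ω₂ := fun _ u φ x => (u : ℂ) ^ k * φ x
  ωW := fun _ t Φ z => ((t.1 : ℂ) * (t.2 : ℂ)) ^ k * Φ z

variable (k : ℕ)

/-- D4 in the model: the theta kernel IS `u ^ k · Σ'_{x ∈ ℚ} φ x`, by unfolding the definition. -/
theorem thetaKernel₁_eq (φ : ℚ → ℂ) (g : Unit) (u : Circle) :
    (circleModel k).thetaKernel₁ φ g u = (u : ℂ) ^ k * ∑' x : ℚ, φ x := by
  show (∑' x : ℚ, (u : ℂ) ^ k * φ x) = _
  exact tsum_mul_left

/-- `hker`-shape: at the base point `u₀ = 1` the theta kernel is the plain sum over the rational points. -/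
theorem thetaKernel₁_one (φ : ℚ → ℂ) (g : Unit) :
    (circleModel k).thetaKernel₁ φ g 1 = ∑' x : ℚ, φ x := by
  rw [thetaKernel₁_eq, Circle.coe_one, one_pow, one_mul]

/-- D5 `hcont` in the model. -/
theorem continuous_thetaKernel₁ (φ : ℚ → ℂ) (g : Unit) :
    Continuous fun u : Circle => (circleModel k).thetaKernel₁ φ g u := by
  simp only [thetaKernel₁_eq]
  exact (continuous_subtype_val.pow k).mul continuous_const

/-- D5 `heq` in the model: weight-`k` equivariance under the torus (here `i = id`, `w t = t ^ k`). -/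
theorem thetaKernel₁_mul (φ : ℚ → ℂ) (g : Unit) (u t : Circle) :
    (circleModel k).thetaKernel₁ φ g (u * t) = (t : ℂ) ^ k * (circleModel k).thetaKernel₁ φ g u := by
  rw [thetaKernel₁_eq, thetaKernel₁_eq, Circle.coe_mul, mul_pow]
  ring

/-! ### The rational and archimedean carriers of the toy -/

/-- `L̂ := ℤ · 1 ⊂ ℚ = V(𝔸_f)`. -/
abbrev Lhat : Submodule ℤ ℚ := ℤ ∙ (1 : ℚ)

/-- `ι_f := id : V(K) = ℚ → V(𝔸_f) = ℚ`. -/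
abbrev ιf : ℚ →ₗ[ℚ] ℚ := LinearMap.id

/-- (Ported verbatim from the HodgeCMPerL package; no docstring in the source.) -/
theorem globalLattice_eq : globalLattice ιf Lhat = Lhat :=
  SetLike.ext fun _ => Iff.rfl

/-- (Ported verbatim from the HodgeCMPerL package; no docstring in the source.) -/
instance : Module.Finite ℤ (globalLattice ιf Lhat) := by
  rw [globalLattice_eq]; infer_instance

/-- (Ported verbatim from the HodgeCMPerL package; no docstring in the source.) -/
instance : Module.Free ℤ (globalLattice ιf Lhat) := by
  rw [globalLattice_eq]; infer_instance

/-- `LE := ℤ · 1 ⊂ ℝ = V_∞`, a discrete lattice (Mathlib `ZSpan` instance). -/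
abbrev LE : Submodule ℤ ℝ := Submodule.span ℤ (Set.range (Basis.singleton Unit ℝ))

/-- `ι_∞ : V(K) = ℚ → V_∞ = ℝ`. -/
abbrev ιR : ℚ →+ ℝ := (Rat.castHom ℝ : ℚ →+* ℝ).toAddMonoidHom

/-- (Ported verbatim from the HodgeCMPerL package; no docstring in the source.) -/
theorem ιR_apply (q : ℚ) : ιR q = (q : ℝ) := rfl

/-- (Ported verbatim from the HodgeCMPerL package; no docstring in the source.) -/
theorem mem_LE_of_mem (v : ℚ) (hv : v ∈ globalLattice ιf Lhat) : ιR v ∈ LE := by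
  rw [globalLattice_eq, Submodule.mem_span_singleton] at hv
  obtain ⟨m, rfl⟩ := hv
  have h1 : (Set.range (Basis.singleton Unit ℝ)) = {(1 : ℝ)} := by
    ext x; simp
  show ((m • (1 : ℚ) : ℚ) : ℝ) ∈ Submodule.span ℤ (Set.range (Basis.singleton Unit ℝ))
  rw [h1, Submodule.mem_span_singleton]
  refine ⟨m, ?_⟩
  rw [zsmul_eq_mul, zsmul_eq_mul, mul_one, mul_one, Rat.cast_intCast]

/-- (Ported verbatim from the HodgeCMPerL package; no docstring in the source.) -/
theorem injOn_ιR : Set.InjOn ιR (globalLattice ιf Lhat : Set ℚ) :=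
  fun _ _ _ _ h => Rat.cast_injective (α := ℝ) h

/-- `φ_N := 1_{x₀ + N ℤ} · (f ∘ ι_∞)` on the rational points. -/
def phiN (f : 𝓢(ℝ, ℂ)) (x₀ : ℚ) (N : ℕ) : ℚ → ℂ :=
  (thinCosetK ιf Lhat x₀ N).indicator fun ξ => f (ιR ξ)

/-! ### Route (E) run in the model -/

/-- **Every hypothesis of `supply₁_of_coset_schwartz` discharged in the weight-`k` circle model**, for any
Borel structure and any finite, open-positive, invariant measure on the circle and any Schwartz `f` with
`f x₀ ≠ 0`: route (E) yields `N ≥ 1` and a continuous unitary character `χ` with `χ(t) · t ^ k = 1`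
whose theta lift of `φ_N` is non-zero. -/
theorem circleModel_supply [MeasurableSpace Circle] [BorelSpace Circle] (ν : Measure Circle)
    [IsFiniteMeasure ν] [ν.IsOpenPosMeasure] [ν.IsMulRightInvariant]
    (f : 𝓢(ℝ, ℂ)) (x₀ : ℚ) (hx₀ : f (x₀ : ℝ) ≠ 0) :
    ∃ (N : ℕ) (χ : PontryaginDual Circle), 0 < N ∧
      (circleModel k).thetaLift₁ ν (fun u => ((χ u : Circle) : ℂ)) (phiN f x₀ N) () ≠ 0 ∧
        ∀ t : Circle, ((χ t : Circle) : ℂ) * (t : ℂ) ^ k = 1 :=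
  supply₁_of_coset_schwartz (circleModel k) ν charSeparating_circle (MonoidHom.id Circle)
    (fun t => (t : ℂ) ^ k) ιf Lhat LE ιR mem_LE_of_mem injOn_ιR f x₀ hx₀ (phiN f x₀) () 1
    (fun N _ => thetaKernel₁_one k (phiN f x₀ N) ())
    (fun N => continuous_thetaKernel₁ k (phiN f x₀ N) ())
    (fun N u t => thetaKernel₁_mul k (phiN f x₀ N) () u t)

/-! ### Closing the last parameters: Borel σ-algebra, Haar measure, a bump function -/

/-- A Schwartz function on `ℝ` equal to `1` at `c`: a smooth bump of radii `1 < 2` around `c`. -/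
def bumpAt (c : ℝ) : ContDiffBump c := ⟨1, 2, one_pos, one_lt_two⟩

/-- (Ported verbatim from the HodgeCMPerL package; no docstring in the source.) -/
theorem hasCompactSupport_bump (c : ℝ) :
    HasCompactSupport fun x : ℝ => ((bumpAt c x : ℝ) : ℂ) :=
  (bumpAt c).hasCompactSupport.comp_left Complex.ofReal_zero

/-- (Ported verbatim from the HodgeCMPerL package; no docstring in the source.) -/
theorem contDiff_bump (c : ℝ) : ContDiff ℝ (⊤ : ℕ∞) fun x : ℝ => ((bumpAt c x : ℝ) : ℂ) :=
  Complex.ofRealCLM.contDiff.comp (bumpAt c).contDiff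

/-- The bump as a Schwartz function. -/
def bump (c : ℝ) : 𝓢(ℝ, ℂ) := (hasCompactSupport_bump c).toSchwartzMap (contDiff_bump c)

/-- (Ported verbatim from the HodgeCMPerL package; no docstring in the source.) -/
theorem bump_apply_self (c : ℝ) : bump c c = 1 := by
  show (((bumpAt c) c : ℝ) : ℂ) = 1
  rw [(bumpAt c).one_of_mem_closedBall (Metric.mem_closedBall_self (bumpAt c).rIn_pos.le),
    Complex.ofReal_one]

/-- The Borel σ-algebra on the circle (Mathlib fixes none); used as a LOCAL instance only. -/
@[reducible] def borelCircle : MeasurableSpace Circle := borel Circle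

attribute [local instance] borelCircle

/-- (Ported verbatim from the HodgeCMPerL package; no docstring in the source.) -/
theorem borelSpace_circle : BorelSpace Circle := ⟨rfl⟩

attribute [local instance] borelSpace_circle

/-- **The closed witness.**  With the Borel σ-algebra and Mathlib's Haar measure on the circle and the bump
at `x₀`: route (E) yields, with NO hypothesis left, some `N ≥ 1` and a continuous unitary character `χ`
of the circle of weight `-k` (`χ(t) · t ^ k = 1`) whose theta lift `∫ θ_{φ_N}((),u) χ(u) du ≠ 0`. -/
theorem circleModel_supply_haar (x₀ : ℚ) :
    ∃ (N : ℕ) (χ : PontryaginDual Circle), 0 < N ∧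
      (circleModel k).thetaLift₁ Measure.haar (fun u => ((χ u : Circle) : ℂ)) (phiN (bump x₀) x₀ N) ()
          ≠ 0 ∧
        ∀ t : Circle, ((χ t : Circle) : ℂ) * (t : ℂ) ^ k = 1 :=
  circleModel_supply k Measure.haar (bump x₀) x₀ (by rw [bump_apply_self]; exact one_ne_zero)

end SupplyToyModel
end PerL34
end HodgeCM

end

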